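import Summits.AtomisticToContinuum.Crystallization.Theorems.ChartedPlanarOrderDoorLayered

/-!
# ChartedPlanarOrder — the OSCILLATION BOOTSTRAP piece beneath the exact Liouville leaf `DoorPeriodic Λ`
# (lens-3 g22; critic row 414 (1)(d) «OscillationImprovement», standing assignment row 416 (4))

Helper file for N = `Theses.ChartedPlanarOrder.ChartedZeroExcessLayered` (stmt-AtomisticToContinuum-26636).

The census (LAT13, TAG 138′ CAMP column) certifies the PERTURBATIVE discrete Liouville mechanism (lens-2's `N″ : LatticeLiouvilleCert →
DoorPeriodic 2`) only for local strain OSCILLATION `≤ 1/32` (fcc) / `≤ 1/16` (hcp), while a door set (`IsDoorSet δ S`: rooted, `δ`-separated,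
(1/16, 9/10, 1)-two-shell clean, single-site Nash, Barlow-bond-charted) is clean only to tolerance `1/16`.  The Liouville slot therefore gains
a typed BOOTSTRAP piece, and `N″` an explicit oscillation parameter `θ`:

* `IsTwoShellAffineGood θ Y q` — the two-shell (18-atom) environment of `q` in `Y` is, atom by atom, within `θ` of an AFFINE image
  `q + T v` (`T : E3 →L[ℝ] E3` arbitrary, `v` over the fcc or hcp two-shell pattern), with the clean coverage clause at radius `27/20`.
  A general `T` absorbs rotation, dilation AND homogeneous strain, so `θ` measures only the NON-AFFINE part of the local displacement —
  the strain oscillation / discrete second gradient at scale 1 — which is the quantity a Campanato-type iteration needs small.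
  (Cleanliness `IsTwoShellGoodSet ε aLo aHi` is the special case `T = a • A`, `A` a linear isometry, `a ∈ [aLo, aHi]`, tolerance `ε·a`.)
* `OscillationImprovement θ` — THE BOOTSTRAP: every door set is `θ`-affine-good at every atom.  Free for `θ ≥ 1/16`
  (`oscillationImprovement_of_ge`, from cleanliness: the calibration of the scale); CONTENT for `θ < 1/16`:
  UNDECIDED · INSTRUMENTABLE (census TAG 154 «CAMP-CLEAN»: are the rearranged non-affine fcc interiors (1/16)-clean and single-site
  stable?  YES ⇒ candidate clean non-affine equilibrium patches, against the bootstrap if they extend to infinite door sets; NO ⇒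
  cleanliness self-improves, supporting it).  A homogeneously strained stationary crystal has oscillation `0`: the bootstrap does NOT claim
  that cleanliness improves, only that its non-affine part does.
* `DoorPeriodicOsc Λ θ` — the exact Liouville leaf RESTRICTED to door sets of oscillation `≤ θ` (what a perturbative `N″(θ)` delivers:
  lens-2 types `N″(Λ, θ) := LatticeLiouvilleCert → DoorPeriodicOsc Λ θ`).
* the seam `doorPeriodic_of_osc : DoorPeriodicOsc Λ θ → OscillationImprovement θ → DoorPeriodic Λ` and the calibrations
  `doorPeriodicOsc_of_doorPeriodic` (the restricted leaf is WEAKER), `DoorPeriodicOsc.anti` / `OscillationImprovement.mono` (monotone in `θ`),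
  `isTwoShellAffineGood_of_good` (clean ⇒ affine-good at tolerance `ε·aHi` when `3·aLo/2 ≥ 27/20`).

Column reading (critic row 409/416): `L1′♮ DoorPeriodic Λ ⟸ DoorPeriodicOsc Λ θ [⟸ L ∧ N″(Λ, θ), lens-2] ∧ OscillationImprovement θ [this
file; UNDECIDED·INSTRUMENTABLE TAG 154]`, at the census literal `θ_osc = 1/32` (fcc window) — or `N″` is made non-perturbative and the
bootstrap is not needed.
-/

open MeasureTheory Set Metric
open Summit.AtomisticToContinuum.Crystallization.Theorems.ChartedPlanarOrderRigidityDoor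
open Summit.AtomisticToContinuum.Crystallization.Theorems.ChartedPlanarOrderDensityDichotomy
open Summit.AtomisticToContinuum.Crystallization.Theorems.ChartedPlanarOrderMesoCut
open Summit.AtomisticToContinuum.Crystallization.Theorems.ChartedPlanarOrderDoorLayered (TwoPeriodic DoorPeriodic)
open Literature.Geometry.DiscreteGeometry (fccTwoShellPattern hcpTwoShellPattern IsTwoShellGoodSet)

namespace Summit.AtomisticToContinuum.Crystallization.Theorems.ChartedPlanarOrderDoorLayeredOsc

/-! ## §1 Affine goodness of a two-shell environment -/

/-- **`θ`-affine-good point of a set**: the point `q` of `Y ⊂ ℝ³` has a two-shell fcc/hcp environment in `Y` that is, atom by atom, within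
`θ` of an AFFINE image of the pattern (`T : E3 →L[ℝ] E3` arbitrary — rotation, dilation and homogeneous strain are absorbed, so `θ` bounds only
the non-affine part of the local displacement), the assignment `f : pattern → Y` being injective on the pattern and hitting every
`y ∈ Y ∖ {q}` within `27/20` of `q` (the clean coverage radius `3a/2` at the smallest clean scale `a = 9/10`). [this file] -/
def IsTwoShellAffineGood (θ : ℝ) (Y : Set E3) (q : E3) : Prop :=
  ∃ (T : E3 →L[ℝ] E3) (P : Finset E3) (f : E3 → E3),
    (P = fccTwoShellPattern ∨ P = hcpTwoShellPattern) ∧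
    (∀ v ∈ P, f v ∈ Y ∧ dist (f v) (q + T v) ≤ θ) ∧ Set.InjOn f ↑P ∧
    ∀ y ∈ Y, y ≠ q → dist y q ≤ 27 / 20 → ∃ v ∈ P, f v = y

/-- Affine goodness is monotone in the tolerance. [this file] -/
theorem IsTwoShellAffineGood.mono {θ θ' : ℝ} (hθ : θ ≤ θ') {Y : Set E3} {q : E3} (h : IsTwoShellAffineGood θ Y q) :
    IsTwoShellAffineGood θ' Y q := by
  obtain ⟨T, P, f, hP, hf, hinj, hcov⟩ := h
  exact ⟨T, P, f, hP, fun v hv => ⟨(hf v hv).1, (hf v hv).2.trans hθ⟩, hinj, hcov⟩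

/-- **Clean ⇒ affine-good** (calibration of the scale): an `(ε, aLo, aHi)`-two-shell-good point with `0 ≤ ε`, `0 < aLo`, `27/20 ≤ 3·aLo/2`
is `θ`-affine-good for every `θ ≥ ε·aHi` — take `T = a • A`. [this file] -/
theorem isTwoShellAffineGood_of_good {ε aLo aHi θ : ℝ} (hε : 0 ≤ ε) (haLo : 27 / 20 ≤ 3 / 2 * aLo) (hθ : ε * aHi ≤ θ)
    {Y : Set E3} {q : E3} (h : IsTwoShellGoodSet ε aLo aHi Y q) : IsTwoShellAffineGood θ Y q := by
  obtain ⟨a, haLo', haHi, A, P, f, hP, hf, hinj, hcov⟩ := h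
  refine ⟨a • A.toContinuousLinearMap, P, f, hP, fun v hv => ⟨(hf v hv).1, ?_⟩, hinj, fun y hy hyq hd => hcov y hy hyq ?_⟩
  · have h1 : dist (f v) (q + a • A v) ≤ ε * a := (hf v hv).2
    have h2 : ε * a ≤ ε * aHi := mul_le_mul_of_nonneg_left haHi hε
    simpa using h1.trans (h2.trans hθ)
  · exact hd.trans (haLo.trans (by nlinarith))

/-! ## §2 The bootstrap piece, the restricted Liouville leaf, the seam -/

/-- **`OscillationImprovement θ`** — THE BOOTSTRAP PIECE (critic row 414 (1)(d)): every door set is `θ`-affine-good at every atom, i.e. its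
local strain OSCILLATION (the non-affine part of the two-shell environment) is `≤ θ`.  Free for `θ ≥ 1/16` (`oscillationImprovement_of_ge`);
UNDECIDED · INSTRUMENTABLE (census TAG 154 CAMP-CLEAN) below. [this file] -/
def OscillationImprovement (θ : ℝ) : Prop :=
  ∀ δ : ℝ, 0 < δ → ∀ S : Set E3, IsDoorSet δ S → ∀ q ∈ S, IsTwoShellAffineGood θ S q

/-- **`DoorPeriodicOsc Λ θ`** — the exact Liouville leaf `DoorPeriodic Λ` RESTRICTED to door sets of oscillation `≤ θ`: what a PERTURBATIVE
nonlinear transfer delivers (lens-2: `N″(Λ, θ) := LatticeLiouvilleCert → DoorPeriodicOsc Λ θ`; census window `θ ≤ 1/32` fcc, `≤ 1/16` hcp).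
[this file] -/
def DoorPeriodicOsc (Λ θ : ℝ) : Prop :=
  ∀ δ : ℝ, 0 < δ → ∀ S : Set E3, IsDoorSet δ S → (∀ q ∈ S, IsTwoShellAffineGood θ S q) → TwoPeriodic Λ S

/-- **THE SEAM**: restricted leaf ∧ bootstrap ⇒ the exact Liouville leaf `L1′♮`. [this file] -/
theorem doorPeriodic_of_osc {Λ θ : ℝ} (hN : DoorPeriodicOsc Λ θ) (hB : OscillationImprovement θ) : DoorPeriodic Λ :=
  fun δ hδ S hS => hN δ hδ S hS (hB δ hδ S hS)

/-- The restricted leaf is WEAKER than the leaf. [this file] -/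
theorem doorPeriodicOsc_of_doorPeriodic {Λ : ℝ} (h : DoorPeriodic Λ) (θ : ℝ) : DoorPeriodicOsc Λ θ :=
  fun δ hδ S hS _ => h δ hδ S hS

/-- The restricted leaf is ANTITONE in the oscillation parameter (a larger window is a stronger statement). [this file] -/
theorem DoorPeriodicOsc.anti {Λ θ θ' : ℝ} (hθ : θ ≤ θ') (h : DoorPeriodicOsc Λ θ') : DoorPeriodicOsc Λ θ :=
  fun δ hδ S hS hosc => h δ hδ S hS fun q hq => (hosc q hq).mono hθ

/-- The bootstrap is MONOTONE in the oscillation parameter. [this file] -/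
theorem OscillationImprovement.mono {θ θ' : ℝ} (hθ : θ ≤ θ') (h : OscillationImprovement θ) : OscillationImprovement θ' :=
  fun δ hδ S hS q hq => (h δ hδ S hS q hq).mono hθ

/-- The atoms of the counting measure `μS S` are the points of `S`. [folklore] -/
theorem mem_iff_μS_singleton_ne_zero (S : Set E3) (p : E3) : μS S {p} ≠ 0 ↔ p ∈ S :=
  Literature.Probability.Process.count_restrict_singleton_ne_zero_iff S p

/-- **CALIBRATION: the bootstrap is FREE at the clean tolerance** — `OscillationImprovement θ` for every `θ ≥ 1/16` (cleanliness
`(1/16, 9/10, 1)` gives `T = a • A`, tolerance `a/16 ≤ 1/16`, coverage `3a/2 ≥ 27/20`).  Content starts strictly below `1/16`. [this file] -/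
theorem oscillationImprovement_of_ge {θ : ℝ} (hθ : 1 / 16 ≤ θ) : OscillationImprovement θ := by
  intro δ _hδ S hS q hq
  have hclean : IsClean (μS S) := hS.2.2.1
  have hset : {p : E3 | μS S {p} ≠ 0} = S := Set.ext fun p => mem_iff_μS_singleton_ne_zero S p
  have hq' : μS S {q} ≠ 0 := (mem_iff_μS_singleton_ne_zero S q).2 hq
  have hgood : IsTwoShellGoodSet (1 / 16) (9 / 10) 1 S q := by simpa [hset] using hclean q hq'
  exact isTwoShellAffineGood_of_good (by norm_num) (by norm_num) (by linarith) hgood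

/-- With the bootstrap at `θ`, a perturbative transfer proved on the window `θ` closes the exact leaf: the column reading
`DoorPeriodic Λ ⟸ DoorPeriodicOsc Λ θ ∧ OscillationImprovement θ` at any `θ' ≤ θ` for the bootstrap and `θ'' ≥ θ` for the transfer. [this file] -/
theorem doorPeriodic_of_osc_window {Λ θ θ' θ'' : ℝ} (h₁ : θ' ≤ θ) (h₂ : θ ≤ θ'') (hN : DoorPeriodicOsc Λ θ'')
    (hB : OscillationImprovement θ') : DoorPeriodic Λ :=
  doorPeriodic_of_osc (hN.anti h₂) (hB.mono h₁)

end Summit.AtomisticToContinuum.Crystallization.Theorems.ChartedPlanarOrderDoorLayeredOsc
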